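import Literature.Analysis.FluidPDE.OnsagerBDSVOscillationPrincipal
import Literature.Analysis.FluidPDE.OnsagerBDSVEnergyPrincipalProofs
import Literature.Analysis.FluidPDE.OnsagerBDSVNonstationaryPhaseAntidiv
import HarnessLib

/-!
# The BDSV principal oscillation term `𝒪₁`: the slow-divergence identity

Buckmaster–De Lellis–Székelyhidi–Vicol (BDSV), *Onsager's conjecture for admissible weak
solutions*, CPAM 72 (2019) = arXiv:1701.08678, §6.1.3, after the expansion (6.10) of
`w_{o,i} ⊗ w_{o,i} - R_{q,i}` in the Fourier modes `ρ_{q,i}∇Φ_i⁻¹C_k(R̃_{q,i})∇Φ_i⁻ᵀe^{iλ_{q+1}k·Φ_i}`: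

> "On the other hand, recalling (5.7) `∇Φ_i⁻¹ C_k ∇Φ_i⁻ᵀ ∇Φ_iᵀ k = 0`, consequently
> `div(Σ_i w_{o,i} ⊗ w_{o,i} - R_{q,i}) = Σ_{i,k≠0} div(ρ_{q,i}∇Φ_i⁻¹C_k(R̃_{q,i})∇Φ_i⁻ᵀ) e^{iλ_{q+1}k·Φ_i}`"

— the derivative never falls on the fast phase. This file proves the physical-space form of this
cancellation for the honest objects of the tree, continuing `OnsagerBDSVOscillationPrincipal.lean`
(which proved (6.10): `w_o ⊗ w_o - R̄_q = Σ_i ρ_{q,i} A 𝕎(R̃_{q,i}, n_{q+1}Φ_i) Aᵀ`, `A = adj ∇Φ_i`,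
`𝕎 = W ⊗ W - R` the mean-free Mikado tensor, `BDSV.principalOscMatrix`), WITHOUT Fourier series:

* the generic cancellation `BDSV.sum_partialDeriv_conjComposite_eq`: for a tensor
  `Σ_{c,d} ρ A_{a'c} A_{jd} w_{cd}(R̃(x), nΦ(x))` built on jointly smooth profiles `w_{cd}(R, ξ)` with
  `Σ_d (∂_{ξ_d} w_{cd})(R̃(x), nΦ(x)) = 0`, the `x`-divergence `Σⱼ ∂ⱼ(…)` consists of slow derivatives
  only — by the composite chain rule `BDSV.partialDeriv_phaseComp` the fast part is
  `n ρ Σ_c A_{a'c} Σ_{d,k} (Σⱼ (∇Φ)_{kj} A_{jd}) c_{∂_k w_{cd}}` and `∇Φ · adj ∇Φ = I`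
  (`BDSV.sum_jac_mul_adjugate`, `det ∇Φ = 1`);
* `div_ξ 𝕎 = 0` on the Mikado domain in the profile language (`BDSV.MikadoDatum.sum_dXi_fluctFam_eq_zero`,
  from `BDSV.MikadoDatum.tensorDivergence_oscMatrix`, Lemma 5.1), and `∂_ξ G̃ = ∂_ξ G` for the
  zero-mean fluctuation `G̃ = BDSV.MikadoDatum.fluctZ` of `OnsagerBDSVEnergyPrincipalTools.lean`;
* the entries of the conjugated tensor in composite form (`BDSV.principalOscMatrix_apply`, amplitudes
  `BDSV.oscAmp = ρ_{q,i} A_{a'c} A_{jd}`), and **the slow-divergence identity**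
  `BDSV.PerturbationData.tensorDivergence_principalOscMatrix_eq`: at a time at which `R̃_{q,i}(t,·)` takes
  values in the Mikado ball (active times, Lemma 5.4),
  `div(ρ_{q,i} A 𝕎(R̃_{q,i}, n_{q+1}Φ_i) Aᵀ) = Σ_{a'} (BDSV.oscSlowDiv … a') e_{a'}` with
  `oscSlowDiv_{a'} = Σ_{j,c,d} [∂ⱼ(ρA_{a'c}A_{jd}) G̃_{cd}(R̃,nΦ) + Σ_{a,b} ρA_{a'c}A_{jd}∂ⱼR̃_{ab} (∂_{R_{ab}}G̃_{cd})(R̃,nΦ)]`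
  — `81 + 729` terms "slow amplitude × composite of a zero-mean profile", the input shape of the
  composite stationary-phase bound for `ℛ` (`OnsagerBDSVNonstationaryPhaseAntidiv.lean`);
* at inactive times the tensor vanishes (`BDSV.tensorDivergence_principalOscMatrix_eq_zero_of_eta`).

## References

* T. Buckmaster, C. De Lellis, L. Székelyhidi Jr., V. Vicol, *Onsager's conjecture for admissible
  weak solutions*, Comm. Pure Appl. Math. 72 (2019) 229–274 = arXiv:1701.08678, §6.1.3
  (arXiv (6.10)–(6.11)), §5.1 Lemma 5.1 with (5.4), (5.7). Equation numbers as in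
  arXiv:1701.08678v1 (cf. `OnsagerBDSVStressSplit.lean`, "Numbering").
-/

open MeasureTheory Set Filter
open scoped NNReal ENNReal ContDiff Matrix Matrix.Norms.Elementwise

noncomputable section

namespace Literature.Analysis.FluidPDE

namespace BDSV

open FunctionSpaces FunctionSpaces.Torus

/-- The flat three-torus `T³ = (ℝ/ℤ)³`, local notation. -/
local notation "𝕋³" => UnitAddTorus (Fin 3)

/-- Euclidean `ℝ³`, local notation. -/
local notation "ℝ³" => EuclideanSpace ℝ (Fin 3)

/-- Real `3 × 3` matrices, local notation. -/
local notation "𝕄" => Matrix (Fin 3) (Fin 3) ℝ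

/-! ## The fast derivative of a conjugated composite tensor cancels -/

section Generic

variable {Rt : 𝕋³ → 𝕄} {D : 𝕋³ → ℝ³} {ρ : 𝕋³ → ℝ} {w : Fin 3 → Fin 3 → 𝕄 → 𝕋³ → ℝ}

/-- **The fast derivative cancels in the divergence of a conjugated composite tensor**: for smooth
`ρ`, `R̃`, `D` with `det ∇Φ(x) = 1`, `A = adj ∇Φ`, and jointly smooth profiles `w_{cd}` whose
composites satisfy `Σ_d c_{∂_{ξ_d} w_{cd}}(x) = 0` (the profile is divergence free in `ξ` at the
point `(R̃(x), nΦ(x))`), the `x`-divergence of the tensor `(ρ A 𝕨∘ Aᵀ)_{a'j} = Σ_{c,d} ρ A_{a'c} A_{jd} c_{w_{cd}}`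
contains only slow derivatives:
`Σⱼ ∂ⱼ(Σ_{c,d} ρA_{a'c}A_{jd} c_{w_{cd}}) = Σ_{j,c,d} [∂ⱼ(ρA_{a'c}A_{jd}) c_{w_{cd}} + Σ_{a,b} ρA_{a'c}A_{jd}∂ⱼR̃_{ab} c_{∂_{R_{ab}}w_{cd}}]`
— the fast part `n ρ Σ_c A_{a'c} Σ_{d,k} (Σⱼ (∇Φ)_{kj}A_{jd}) c_{∂_k w_{cd}} = n ρ Σ_c A_{a'c} Σ_d c_{∂_d w_{cd}}`
vanishes because `∇Φ adj∇Φ = I`. This is the physical-space form of BDSV's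
"`∇Φ_i⁻¹ C_k ∇Φ_i⁻ᵀ ∇Φ_iᵀ k = 0`" ((5.7) in §6.1.3). [cite: BuckmasterEtAl2018, §6.1.3 (use of (5.7))] -/
theorem sum_partialDeriv_conjComposite_eq (hw : ∀ c d, JointSmooth (w c d)) (hRt : IsSmooth Rt)
    (hD : IsSmooth D) (hρ : IsSmooth ρ) (n : ℕ) {x : 𝕋³} (hdet : (jac D x).det = 1)
    (hdiv : ∀ c, ∑ d, phaseComp (dXi d (w c d)) Rt D n x = 0) (a' : Fin 3) :
    ∑ j, Torus.partialDeriv j (fun y => ∑ c, ∑ d, ρ y * (jac D y).adjugate a' c * (jac D y).adjugate j d *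
        phaseComp (w c d) Rt D n y) x =
      ∑ j, ∑ c, ∑ d, (Torus.partialDeriv j (fun y => ρ y * (jac D y).adjugate a' c * (jac D y).adjugate j d) x *
          phaseComp (w c d) Rt D n x +
        ∑ a, ∑ b, (ρ x * (jac D x).adjugate a' c * (jac D x).adjugate j d *
            Torus.partialDeriv j (fun y => Rt y a b) x) *
          phaseComp (dR (Matrix.single a b 1) (w c d)) Rt D n x) := by
  have hA : ∀ m j, IsSmooth fun y => (jac D y).adjugate m j := fun m j =>
    isSmooth_adjugate_jac_entry hD m j
  have hF : ∀ j c d, IsSmooth fun y => ρ y * (jac D y).adjugate a' c * (jac D y).adjugate j d :=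
    fun j c d => (hρ.mul (hA a' c)).mul (hA j d)
  have hc : ∀ c d, IsSmooth (phaseComp (w c d) Rt D n) := fun c d => (hw c d).phaseComp hRt hD n
  -- the chain rule and the product rule, summand by summand
  have hterm : ∀ j c d, Torus.partialDeriv j (fun y => ρ y * (jac D y).adjugate a' c *
      (jac D y).adjugate j d * phaseComp (w c d) Rt D n y) x =
      (Torus.partialDeriv j (fun y => ρ y * (jac D y).adjugate a' c * (jac D y).adjugate j d) x *
          phaseComp (w c d) Rt D n x +
        ∑ a, ∑ b, (ρ x * (jac D x).adjugate a' c * (jac D x).adjugate j d *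
            Torus.partialDeriv j (fun y => Rt y a b) x) *
          phaseComp (dR (Matrix.single a b 1) (w c d)) Rt D n x) +
      (ρ x * (jac D x).adjugate a' c * (jac D x).adjugate j d) *
        ((n : ℝ) * ∑ k, jac D x k j * phaseComp (dXi k (w c d)) Rt D n x) := by
    intro j c d
    rw [partialDeriv_mul ((hF j c d).isContDiff (by simp)) ((hc c d).isContDiff (by simp)),
      partialDeriv_phaseComp (hw c d) hRt hD n j x]
    simp only [mul_add, Finset.mul_sum]
    have e : ∀ a b, ρ x * (jac D x).adjugate a' c * (jac D x).adjugate j d *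
        (Torus.partialDeriv j (fun y => Rt y a b) x * phaseComp (dR (Matrix.single a b 1) (w c d)) Rt D n x) =
        ρ x * (jac D x).adjugate a' c * (jac D x).adjugate j d * Torus.partialDeriv j (fun y => Rt y a b) x *
          phaseComp (dR (Matrix.single a b 1) (w c d)) Rt D n x := fun a b => by ring
    simp only [e]
    ring
  have hsum : ∀ j, Torus.partialDeriv j (fun y => ∑ c, ∑ d, ρ y * (jac D y).adjugate a' c *
      (jac D y).adjugate j d * phaseComp (w c d) Rt D n y) x =
      ∑ c, ∑ d, Torus.partialDeriv j (fun y => ρ y * (jac D y).adjugate a' c *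
        (jac D y).adjugate j d * phaseComp (w c d) Rt D n y) x := by
    intro j
    rw [partialDeriv_sum_three (fun c => Torus.isSmooth_finset_sum _ fun d _ =>
      (hF j c d).mul (hc c d)) j x]
    exact Finset.sum_congr rfl fun c _ => partialDeriv_sum_three (fun d => (hF j c d).mul (hc c d)) j x
  simp only [hsum, hterm, Finset.sum_add_distrib]
  -- the fast part vanishes
  have hfast : ∑ j, ∑ c, ∑ d, (ρ x * (jac D x).adjugate a' c * (jac D x).adjugate j d) *
      ((n : ℝ) * ∑ k, jac D x k j * phaseComp (dXi k (w c d)) Rt D n x) = 0 := by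
    have e1 : ∑ j, ∑ c, ∑ d, (ρ x * (jac D x).adjugate a' c * (jac D x).adjugate j d) *
        ((n : ℝ) * ∑ k, jac D x k j * phaseComp (dXi k (w c d)) Rt D n x) =
        ∑ c, ρ x * (jac D x).adjugate a' c * (n : ℝ) *
          ∑ d, ∑ k, (∑ j, jac D x k j * (jac D x).adjugate j d) * phaseComp (dXi k (w c d)) Rt D n x := by
      rw [Finset.sum_comm]
      refine Finset.sum_congr rfl fun c _ => ?_
      rw [Finset.mul_sum, Finset.sum_comm]
      refine Finset.sum_congr rfl fun d _ => ?_
      simp only [Finset.mul_sum, Finset.sum_mul]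
      rw [Finset.sum_comm]
      exact Finset.sum_congr rfl fun k _ => Finset.sum_congr rfl fun j _ => by ring
    rw [e1]
    refine Finset.sum_eq_zero fun c _ => ?_
    have e2 : ∀ d, ∑ k, (∑ j, jac D x k j * (jac D x).adjugate j d) * phaseComp (dXi k (w c d)) Rt D n x =
        phaseComp (dXi d (w c d)) Rt D n x := by
      intro d
      simp only [sum_jac_mul_adjugate hdet, ite_mul, one_mul, zero_mul, Finset.sum_ite_eq',
        Finset.mem_univ, if_true]
    simp only [e2, hdiv c, mul_zero]
  rw [hfast, add_zero]

end Generic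

/-! ## The Mikado fluctuation: `ξ`-derivatives and `div_ξ = 0` -/

section Fluct

variable {r : ℝ} (𝔚 : MikadoDatum r)

/-- `∂_ξ G̃ = ∂_ξ G`: the zero-mean fluctuation differs from the fluctuation by a `ξ`-constant. [folklore] -/
theorem MikadoDatum.dXi_fluctZ (c d k : Fin 3) : dXi k (𝔚.fluctZ c d) = dXi k (𝔚.fluctFam c d) := by
  funext R ξ
  exact partialDeriv_sub_const _ _ k ξ

/-- The fluctuation entries are the entries of the mean-free Mikado tensor `𝕎 = W ⊗ W - R`. [folklore] -/
theorem MikadoDatum.fluctFam_eq_oscMatrix (c d : Fin 3) (R : 𝕄) (ξ : 𝕋³) :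
    𝔚.fluctFam c d R ξ = 𝔚.oscMatrix R ξ c d := by
  rw [MikadoDatum.fluctFam_apply, MikadoDatum.oscMatrix_apply]

/-- **`Σ_d ∂_{ξ_d} G_{cd}(R, ·) = 0` on the Mikado domain** (`div_ξ (W ⊗ W - R) = 0`, Lemma 5.1;
the physical-space form of `C_k k = 0`, (5.7)). [cite: BuckmasterEtAl2018, Lemma 5.1 (5.4) and (5.7)] -/
theorem MikadoDatum.sum_dXi_fluctFam_eq_zero {R : 𝕄} (hR : R ∈ Metric.closedBall (1 : 𝕄) r)
    (hs : R.IsSymm) (c : Fin 3) (ξ : 𝕋³) : ∑ d, dXi d (𝔚.fluctFam c d) R ξ = 0 := by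
  have h := congrArg (fun v : ℝ³ => v c) (𝔚.tensorDivergence_oscMatrix hR hs ξ)
  simp only [PiLp.zero_apply] at h
  rw [← h, Torus.tensorDivergence, WithLp.ofLp_sum, Finset.sum_apply]
  refine Finset.sum_congr rfl fun d _ => ?_
  have hcol : IsSmooth (fun ζ => colsOf (𝔚.oscMatrix R ζ) d) := (𝔚.isSmooth_colsOf_oscMatrix R).column d
  rw [show (WithLp.ofLp (Torus.partialDeriv d (fun ζ => colsOf (𝔚.oscMatrix R ζ) d) ξ)) c =
      Torus.partialDeriv d (fun ζ => colsOf (𝔚.oscMatrix R ζ) d) ξ c from rfl,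
    partialDeriv_apply_eq hcol d c ξ]
  unfold dXi
  congr 1

end Fluct

/-! ## The slow-divergence identity for the conjugated mean-free Mikado tensor -/

section SlowDiv

variable (P : Params) (S : Setting)

/-- **The conjugation amplitudes** `ρ_{q,i} A_{a'c} A_{jd}`, `A = adj ∇Φ_i`, of the entries
`(ρ_i A 𝕎 Aᵀ)_{a'j} = Σ_{c,d} ρ_i A_{a'c} A_{jd} 𝕎_{cd}` of the conjugated mean-free Mikado tensor.
[cite: BuckmasterEtAl2018, §6.1.3 (arXiv (6.10))] -/
def oscAmp (η : ℕ → ℝ → 𝕋³ → ℝ) (D : ℕ → ℝ → 𝕋³ → ℝ³) (i : ℕ) (t : ℝ) (a' j c d : Fin 3)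
    (x : 𝕋³) : ℝ :=
  rhoI P S η i t x * (jac (D i t) x).adjugate a' c * (jac (D i t) x).adjugate j d

/-- **The slow divergence** of the conjugated mean-free Mikado tensor, component `a'`:
`Σ_{j,c,d} [∂ⱼ(ρA_{a'c}A_{jd}) · G̃_{cd}(R̃, nΦ) + Σ_{a,b} ρA_{a'c}A_{jd}∂ⱼR̃_{ab} · (∂_{R_{ab}}G̃_{cd})(R̃, nΦ)]`
— `81 + 729` terms "slow amplitude × composite of a zero-mean profile".
[cite: BuckmasterEtAl2018, §6.1.3 (arXiv (6.10)–(6.11))] -/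
def oscSlowDiv (𝔚 : MikadoDatum mikadoRadius) (η : ℕ → ℝ → 𝕋³ → ℝ) (D : ℕ → ℝ → 𝕋³ → ℝ³) (i : ℕ)
    (t : ℝ) (a' : Fin 3) (x : 𝕋³) : ℝ :=
  ∑ j, ∑ c, ∑ d, (Torus.partialDeriv j (oscAmp P S η D i t a' j c d) x *
      phaseComp (𝔚.fluctZ c d) (fun y => tildeR P S η D i t y) (D i t) (P.freqNat (S.q + 1)) x +
    ∑ a, ∑ b, (oscAmp P S η D i t a' j c d x * Torus.partialDeriv j (fun y => tildeR P S η D i t y a b) x) *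
      phaseComp (dR (Matrix.single a b 1) (𝔚.fluctZ c d)) (fun y => tildeR P S η D i t y) (D i t)
        (P.freqNat (S.q + 1)) x)

variable {P S}

/-- **Entries of the conjugated tensor in composite form**:
`(ρ_i A 𝕎(R̃, nΦ) Aᵀ)_{a'j} = Σ_{c,d} (ρ_i A_{a'c} A_{jd}) · G_{cd}(R̃(x), nΦ(x))`. [folklore] -/
theorem principalOscMatrix_apply (𝔚 : MikadoDatum mikadoRadius) (η : ℕ → ℝ → 𝕋³ → ℝ)
    (D : ℕ → ℝ → 𝕋³ → ℝ³) (i : ℕ) (t : ℝ) (x : 𝕋³) (a' j : Fin 3) :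
    principalOscMatrix P S 𝔚 η D i t x a' j =
      ∑ c, ∑ d, oscAmp P S η D i t a' j c d x *
        phaseComp (𝔚.fluctFam c d) (fun y => tildeR P S η D i t y) (D i t) (P.freqNat (S.q + 1)) x := by
  have e1 : ∀ c d, 𝔚.oscMatrix (tildeR P S η D i t x) (P.freqNat (S.q + 1) • phiPoint D i t x) c d =
      phaseComp (𝔚.fluctFam c d) (fun y => tildeR P S η D i t y) (D i t) (P.freqNat (S.q + 1)) x := by
    intro c d
    rw [← 𝔚.fluctFam_eq_oscMatrix]
    rfl
  have e2 : gradPhi D i t x = jac (D i t) x := rfl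
  rw [principalOscMatrix, Matrix.smul_apply, smul_eq_mul, Matrix.mul_apply, Finset.mul_sum, e2]
  rw [Finset.sum_comm]
  refine Finset.sum_congr rfl fun c _ => ?_
  simp only [Matrix.mul_apply, Matrix.transpose_apply, Finset.sum_mul, Finset.mul_sum]
  refine Finset.sum_congr rfl fun d _ => ?_
  rw [e1, oscAmp]
  ring

variable {Nbar : ℕ} {Cin C₀ c₀ : ℝ} {Cη : ℕ → ℕ → ℝ}

/-- The columns of the `i`-th conjugated mean-free Mikado tensor form a smooth tensor field at each
time of `[0,T]` (under the standing hypotheses with `c₀ > 0`, `ρ_q > 0`). [folklore] -/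
theorem PerturbationData.isSmooth_principalOscCols (H : PerturbationHypotheses P S Nbar Cin C₀)
    (𝒟 : PerturbationData P S c₀ Cη) (𝔚 : MikadoDatum mikadoRadius) (hc₀ : 0 < c₀)
    (hρ : ∀ s ∈ Icc 0 S.T, 0 < rhoQ P S s) (i : ℕ) {t : ℝ} (ht : t ∈ Icc 0 S.T) :
    IsSmooth (fun y j => colsOf (principalOscMatrix P S 𝔚 𝒟.cut.η 𝒟.D i t y) j) := by
  have hSD : SmoothData P S 𝒟.cut.η 𝒟.D := H.toSmoothData hc₀ 𝒟 hρ
  have hρs : IsSmooth (rhoI P S 𝒟.cut.η i t) := (hSD.rhoI i).isSmooth_slice ht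
  have hRt : IsSmooth fun y => tildeR P S 𝒟.cut.η 𝒟.D i t y :=
    𝒟.isSmooth_tildeR H (fun s hs => (hρ s hs).ne') i ht
  have hDt : IsSmooth (𝒟.D i t) := (𝒟.flow i).smooth.isSmooth_slice ht
  refine contDiff_pi.2 fun j => contDiff_euclidean.2 fun a' => ?_
  have heq : (fun y => colsOf (principalOscMatrix P S 𝔚 𝒟.cut.η 𝒟.D i t y) j a') = fun y =>
      ∑ c, ∑ d, oscAmp P S 𝒟.cut.η 𝒟.D i t a' j c d y *
        phaseComp (𝔚.fluctFam c d) (fun z => tildeR P S 𝒟.cut.η 𝒟.D i t z) (𝒟.D i t)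
          (P.freqNat (S.q + 1)) y := by
    funext y
    rw [colsOf_apply, principalOscMatrix_apply]
  have h := Torus.isSmooth_finset_sum (Finset.univ : Finset (Fin 3)) (f := fun c y => ∑ d,
    oscAmp P S 𝒟.cut.η 𝒟.D i t a' j c d y *
      phaseComp (𝔚.fluctFam c d) (fun z => tildeR P S 𝒟.cut.η 𝒟.D i t z) (𝒟.D i t) (P.freqNat (S.q + 1)) y)
    fun c _ => Torus.isSmooth_finset_sum _ fun d _ =>
      ((hρs.mul (isSmooth_adjugate_jac_entry hDt a' c)).mul (isSmooth_adjugate_jac_entry hDt j d)).mul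
        ((𝔚.jointSmooth_fluctFam c d).phaseComp hRt hDt _)
  have h' : IsSmooth (fun y => colsOf (principalOscMatrix P S 𝔚 𝒟.cut.η 𝒟.D i t y) j a') := by
    rw [heq]; exact h
  exact h'

/-- **The slow-divergence identity** (BDSV §6.1.3: with (6.10) and "(5.7)
`∇Φ_i⁻¹C_k∇Φ_i⁻ᵀ∇Φ_iᵀ k = 0`, consequently
`div(Σ_i w_{o,i} ⊗ w_{o,i} - R_{q,i}) = Σ_{i,k≠0} div(ρ_{q,i}∇Φ_i⁻¹C_k(R̃_{q,i})∇Φ_i⁻ᵀ) e^{iλ_{q+1}k·Φ_i}`",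
i.e. only slow derivatives survive): under the standing hypotheses with `a ≥ 1`, `c₀ > 0`, `ρ_q > 0`
on `[0,T]`, at a time `t ∈ [0,T]` at which `R̃_{q,i}(t,·)` takes values in the Mikado ball (an active
time, Lemma 5.4), the divergence of the `i`-th conjugated mean-free Mikado tensor
`ρ_{q,i} adj∇Φ_i 𝕎(R̃_{q,i}, n_{q+1}Φ_i) adj∇Φ_iᵀ` is the slow divergence `BDSV.oscSlowDiv`:
the fast derivative `n ρ_i Σ_c A_{a'c} (div_ξ 𝕎)_c(R̃, nΦ)` vanishes (`∇Φ adj∇Φ = I`, `div_ξ 𝕎 = 0`).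
[cite: BuckmasterEtAl2018, §6.1.3 (arXiv (6.10) and the display after it)] -/
theorem PerturbationData.tensorDivergence_principalOscMatrix_eq (H : PerturbationHypotheses P S Nbar Cin C₀)
    (𝒟 : PerturbationData P S c₀ Cη) (𝔚 : MikadoDatum mikadoRadius) (ha : 1 ≤ P.a) (hc₀ : 0 < c₀)
    (hρ : ∀ s ∈ Icc 0 S.T, 0 < rhoQ P S s) {i : ℕ} {t : ℝ} (ht : t ∈ Icc 0 S.T)
    (hball : ∀ y, tildeR P S 𝒟.cut.η 𝒟.D i t y ∈ Metric.closedBall (1 : 𝕄) mikadoRadius) (x : 𝕋³) :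
    Torus.tensorDivergence (fun y j => colsOf (principalOscMatrix P S 𝔚 𝒟.cut.η 𝒟.D i t y) j) x =
      ∑ a', oscSlowDiv P S 𝔚 𝒟.cut.η 𝒟.D i t a' x • EuclideanSpace.single a' (1 : ℝ) := by
  -- smoothness of the players at time `t`
  have hSD : SmoothData P S 𝒟.cut.η 𝒟.D := H.toSmoothData hc₀ 𝒟 hρ
  have hρs : IsSmooth (rhoI P S 𝒟.cut.η i t) := (hSD.rhoI i).isSmooth_slice ht
  have hRt : IsSmooth fun y => tildeR P S 𝒟.cut.η 𝒟.D i t y :=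
    𝒟.isSmooth_tildeR H (fun s hs => (hρ s hs).ne') i ht
  have hDt : IsSmooth (𝒟.D i t) := (𝒟.flow i).smooth.isSmooth_slice ht
  have hdet : ∀ y, (jac (𝒟.D i t) y).det = 1 := fun y => 𝒟.det_gradPhi_eq_one H ha i ht y
  have hsym : ∀ y, (tildeR P S 𝒟.cut.η 𝒟.D i t y).IsSymm := fun y =>
    isSymm_tildeR (fun p q => H.eulerReynolds.symm t ht y p q) i
  set n : ℕ := P.freqNat (S.q + 1) with hndef
  -- `G = G̃` along the frame (as functions of `y`)
  have hGeq : ∀ c d, phaseComp (𝔚.fluctFam c d) (fun y => tildeR P S 𝒟.cut.η 𝒟.D i t y) (𝒟.D i t) n =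
      phaseComp (𝔚.fluctZ c d) (fun y => tildeR P S 𝒟.cut.η 𝒟.D i t y) (𝒟.D i t) n := by
    intro c d
    funext y
    unfold phaseComp
    exact (𝔚.fluctZ_eq_of_mem c d (hball y) (hsym y) _).symm
  -- `div_ξ G̃ = 0` along the frame
  have hdiv : ∀ c, ∑ d, phaseComp (dXi d (𝔚.fluctZ c d)) (fun y => tildeR P S 𝒟.cut.η 𝒟.D i t y)
      (𝒟.D i t) n x = 0 := by
    intro c
    unfold phaseComp
    simp only [𝔚.dXi_fluctZ]
    exact 𝔚.sum_dXi_fluctFam_eq_zero (hball x) (hsym x) c _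
  have hS := 𝒟.isSmooth_principalOscCols H 𝔚 hc₀ hρ i ht
  -- componentwise: `v = Σ_{a'} v_{a'} e_{a'}`
  have hbasis : ∀ v : ℝ³, v = ∑ a', v a' • EuclideanSpace.single a' (1 : ℝ) := by
    intro v
    conv_lhs => rw [← (EuclideanSpace.basisFun (Fin 3) ℝ).sum_repr v]
    simp [EuclideanSpace.basisFun_apply]
  refine (hbasis _).trans (Finset.sum_congr rfl fun a' _ => ?_)
  congr 1
  rw [Torus.tensorDivergence, WithLp.ofLp_sum, Finset.sum_apply]
  have hcomp : ∀ j, (WithLp.ofLp (Torus.partialDeriv j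
      (fun y => colsOf (principalOscMatrix P S 𝔚 𝒟.cut.η 𝒟.D i t y) j) x)) a' =
      Torus.partialDeriv j (fun y => ∑ c, ∑ d, oscAmp P S 𝒟.cut.η 𝒟.D i t a' j c d y *
        phaseComp (𝔚.fluctZ c d) (fun z => tildeR P S 𝒟.cut.η 𝒟.D i t z) (𝒟.D i t) n y) x := by
    intro j
    rw [show (WithLp.ofLp (Torus.partialDeriv j
        (fun y => colsOf (principalOscMatrix P S 𝔚 𝒟.cut.η 𝒟.D i t y) j) x)) a' =
        Torus.partialDeriv j (fun y => colsOf (principalOscMatrix P S 𝔚 𝒟.cut.η 𝒟.D i t y) j) x a' from rfl,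
      partialDeriv_apply_eq (hS.column j) j a' x]
    congr 1
    funext y
    rw [colsOf_apply, principalOscMatrix_apply, ← hndef]
    simp only [hGeq]
  simp only [hcomp]
  have key := sum_partialDeriv_conjComposite_eq (w := fun c d => 𝔚.fluctZ c d) (ρ := rhoI P S 𝒟.cut.η i t)
    (fun c d => 𝔚.jointSmooth_fluctZ c d) hRt hDt hρs n (hdet x) hdiv a'
  simp only [oscAmp, oscSlowDiv]
  exact key

/-- Off the support of `η_i(t,·)` the conjugated tensor vanishes identically (`ρ_{q,i} = η_i² ρ_q/Σ∫η_j²`).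
[folklore] -/
theorem principalOscMatrix_eq_zero_of_eta (𝔚 : MikadoDatum mikadoRadius) (η : ℕ → ℝ → 𝕋³ → ℝ)
    (D : ℕ → ℝ → 𝕋³ → ℝ³) {i : ℕ} {t : ℝ} (hη : ∀ x, η i t x = 0) (x : 𝕋³) :
    principalOscMatrix P S 𝔚 η D i t x = 0 := by
  rw [principalOscMatrix, rhoI, hη x]
  simp

/-- Hence its divergence vanishes at such times. [folklore] -/
theorem tensorDivergence_principalOscMatrix_eq_zero_of_eta (𝔚 : MikadoDatum mikadoRadius)
    (η : ℕ → ℝ → 𝕋³ → ℝ) (D : ℕ → ℝ → 𝕋³ → ℝ³) {i : ℕ} {t : ℝ} (hη : ∀ x, η i t x = 0) :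
    Torus.tensorDivergence (fun y j => colsOf (principalOscMatrix P S 𝔚 η D i t y) j) = fun _ => 0 := by
  funext x
  have h : (fun y j => colsOf (principalOscMatrix P S 𝔚 η D i t y) j) = fun _ _ => (0 : ℝ³) := by
    funext y j
    rw [principalOscMatrix_eq_zero_of_eta 𝔚 η D hη y, colsOf_zero]
  rw [h]
  exact Torus.tensorDivergence_zero x

end SlowDiv


end BDSV

end Literature.Analysis.FluidPDE
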